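import Summits.CriticalPhenomena.PercolationContinuityZ3.Theorems.Transplant.Slab111VLevels
import HarnessLib
/-!
# The routing certificate for `ShapedLinkage 3 (Slab111.hexShadow k)`, VI′: the LEVEL LEMMAS — placing a checked plan of each kind

builds on p205010 (kernel theorem, internal audit signed; external expert review pending) — NOT used in this file.  Lane `prim-bschramm`, seat
`prim-bschramm-p2` (gen 35; class C1b; memo `HOME/bschramm/P2-LATTICES.md` §129); helper file (`--supports stmt-CriticalPhenomena-4575 --as helper`).
The bridge from the certificate data («Slab111VPlan»: a plan `P` with `P.check`, `P.fits c₁ c₂ c₃`, `P.kmin ≤ KMAX ≤ k`, `P.allows` the terminals'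
statuses) to the hypotheses of `swap_of_check` («Slab111VSwap»): for each KIND the reference level `ℓ` is chosen (`free`: by a residue argument
inside `[−λmin, k − λmax]`; `bot ℓ₀`: `ℓ₀`; `top m`: `k − m`; `stk λ₀`: `h_low − λ₀`), the level facts `LevelOK` follow from the checker's contact
conditions («Slab111VLevels»), and `Serves` from `fits`/`allows` and the envelope bounds.
* **`swap_of_plan`** (all kinds; for `stk` the caller supplies `c₁ = c₂` and the orientation).
[cite: DuminilCopinSidoraviciusTassion2016, §2.3 (proof of Fact 2)]
-/

noncomputable section

namespace Summit.CriticalPhenomena.PercolationContinuityZ3.Theorems.Transplant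

open Literature.Probability.Percolation Literature.Probability.LatticeModels SimpleGraph
open scoped Classical

namespace Slab111

variable {k : ℕ}

/-! ## The swap pair of a plan -/

/-- An exact terminal option pins the terminal: from its column and its level. [folklore] -/
theorem serves_exact {z : Site 2} {ℓ : ℤ} (hℓ : ℓ % 3 = (cls z : ℤ)) {C : Ctx} {P : PlanD} {ℓ'} (hL : LevelOK k C ℓ P) (hv0 : ∀ w ∈ P.rigid, vOK w = true)
    {v : MV} (hv : v ∈ P.rigid) {X : slab111 k} (hs : sh X = vcol z v.1) (hl : lev (X : Site 3) = ℓ + v.2) (_h : ℓ' = ℓ) :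
    Serves k z ℓ C (TermD.exact v) X := by
  show X = absV k z ℓ v
  exact eq_absV_of_sh_lev (madm_absV hℓ (hv0 v hv) (hL.1 v hv).1 (hL.1 v hv).2.1) (by rw [hs]; rfl) hl

/-- **THE SWAP PAIR OF A CERTIFIED PLAN.**  `k ≥ KMAX`; a plan checked in the block's context, fitting the terminal columns, with `kmin ≤ KMAX`,
serving the terminals' statuses; for a stack plan additionally `E₁, E₂` over one column in the plan's orientation.  Then the terminals admit a swap
pair of routings in the cleared set. [cite: DuminilCopinSidoraviciusTassion2016, §2.3 (proof of Fact 2)] -/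
theorem swap_of_plan {z : Site 2} {K : BKey} (hk : KMAX ≤ (k : ℤ)) {P : PlanD} (hP : P.check (Ctx.of K (cls z) (k % 3)) = true)
    (hkm : P.kmin ≤ KMAX) {c1 c2 c3 : Col} (hfit : P.fits c1 c2 c3 = true)
    {E₁ E₂ w' : slab111 k} (hne : E₁ ≠ E₂)
    (hE₁ : E₁ ∈ Wset k z K.tR K.tD K.sR K.sD ∩ (hexShadow k).lift (blkR 3 z K.tR K.sR))
    (hE₂ : E₂ ∈ Wset k z K.tR K.tD K.sR K.sD ∩ (hexShadow k).lift (blkR 3 z K.tR K.sR)) (hw' : w' ∈ Wset k z K.tR K.tD K.sR K.sD)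
    (hc1 : sh E₁ = vcol z c1) (hc2 : sh E₂ = vcol z c2) (hc3 : sh w' = vcol z c3)
    (hal : P.allows (Ctx.of K (cls z) (k % 3)) (statusOf k (lev (E₁ : Site 3))) (statusOf k (lev (E₂ : Site 3))) (statusOf k (lev (w' : Site 3))) = true)
    (hstk : ∀ lam0 low, P.kind = Kind.stk lam0 low → c1 = c2 ∧ (if low then lev (E₁ : Site 3) < lev (E₂ : Site 3) else lev (E₂ : Site 3) < lev (E₁ : Site 3))) :
    ∃ r₁ r₂ : VRouteData (film k) (Wset k z K.tR K.tD K.sR K.sD ∩ (hexShadow k).lift (blkR 3 z K.tR K.sR)) (Wset k z K.tR K.tD K.sR K.sD) E₁ E₂ w',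
      r₁.y = r₂.b ∧ r₁.b = r₂.y := by
  have hk5 : 5 ≤ k := by unfold KMAX at hk; omega
  set C := Ctx.of K (cls z) (k % 3) with hC
  set h₁ := lev (E₁ : Site 3); set h₂ := lev (E₂ : Site 3); set h₃ := lev (w' : Site 3)
  have hh1 : 0 ≤ h₁ ∧ h₁ ≤ k := ⟨(adm_self E₁).2.1, (adm_self E₁).2.2⟩
  have hh2 : 0 ≤ h₂ ∧ h₂ ≤ k := ⟨(adm_self E₂).2.1, (adm_self E₂).2.2⟩
  have hh3 : 0 ≤ h₃ ∧ h₃ ≤ k := ⟨(adm_self w').2.1, (adm_self w').2.2⟩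
  have hcls1 := dvd_level_cls hc1; have hcls2 := dvd_level_cls hc2; have hcls3 := dvd_level_cls hc3
  -- unpack the parts of the checker used here
  have hP' := hP
  simp only [PlanD.check, Bool.and_eq_true] at hP'
  obtain ⟨⟨⟨⟨⟨⟨⟨-, hvalid⟩, -⟩, hport⟩, -⟩, -⟩, henv⟩, hlev⟩ := hP'
  have hv0 : ∀ w ∈ P.rigid, vOK w = true := by
    simp only [PlanD.validOK, Bool.and_eq_true, List.all_eq_true] at hvalid
    intro w hw
    rcases mem_rigid_iff.1 hw with h | rfl | rfl | h | h | h
    · exact (hvalid.1 _ (by simp [h])).1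
    · exact (hvalid.1 _ (by simp)).1
    · exact (hvalid.1 _ (by simp)).1
    · exact (hvalid.1 _ (by simp [h])).1
    · exact (hvalid.2 _ (by simp [h])).1
    · exact (hvalid.2 _ (by simp [h])).1
  simp only [PlanD.portOK, Bool.and_eq_true] at hport
  obtain ⟨⟨⟨hp1, hp2⟩, hp3a⟩, hp3b⟩ := hport
  -- exact terminal vertices are rigid
  have hex1 : ∀ v, P.t1 = TermD.exact v → v ∈ P.rigid := by
    intro v hv; rw [hv] at hp1; revert hp1; cases hA : P.A.head? <;> simp [TermD.isPort]
    rintro rfl; exact mem_rigid_iff.2 (Or.inl (List.mem_of_mem_head? hA))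
  have hex2 : ∀ v, P.t2 = TermD.exact v → v ∈ P.rigid := by
    intro v hv; rw [hv] at hp2; revert hp2; cases hB : P.B.getLast? <;> simp [TermD.isPort]
    rintro rfl; exact mem_rigid_iff.2 (Or.inr (Or.inr (Or.inr (Or.inl (List.mem_of_getLast? hB)))))
  have hex3a : ∀ v, P.t3a = TermD.exact v → v ∈ P.rigid := by
    intro v hv; rw [hv] at hp3a; revert hp3a; cases hT : P.T1.getLast? <;> simp [TermD.isPort]
    rintro rfl; exact mem_rigid_iff.2 (Or.inr (Or.inr (Or.inr (Or.inr (Or.inl (List.mem_of_getLast? hT))))))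
  have hex3b : ∀ v, P.t3b = TermD.exact v → v ∈ P.rigid := by
    intro v hv; rw [hv] at hp3b; revert hp3b; cases hT : P.T2.getLast? <;> simp [TermD.isPort]
    rintro rfl; exact mem_rigid_iff.2 (Or.inr (Or.inr (Or.inr (Or.inr (Or.inr (List.mem_of_getLast? hT))))))
  -- fits and allows, per terminal
  simp only [PlanD.fits, Bool.and_eq_true, beq_iff_eq] at hfit
  obtain ⟨⟨⟨hf1, hf2⟩, hf3a⟩, hf3b⟩ := hfit
  simp only [PlanD.allows, Bool.and_eq_true] at hal
  obtain ⟨⟨⟨ha1, ha2⟩, ha3a⟩, ha3b⟩ := hal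
  -- the generic `Serves` for a ride term with envelope `any`, and the status facts
  have serves_ride_any : ∀ {t : TermD} {a : AttD} {X : slab111 k} {c : Col}, t = TermD.ride a Env.any → t.col = c → sh X = vcol z c →
      t.allows C P.kind (statusOf k (lev (X : Site 3))) = true → ∀ ℓ, Serves k z ℓ C t X := by
    intro t a X c ht hcol hs hal ℓ
    subst ht
    simp only [TermD.col] at hcol
    simp only [TermD.allows, Bool.and_eq_true] at hal
    exact ⟨hcol ▸ hs, hal.1.1, trivial⟩
  -- case on the kind
  rcases hkind : P.kind with _ | ell | m | ⟨lam0, low⟩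
  · ---------------------------------------------------------------- free
    simp only [PlanD.levelsOK, hkind, Bool.and_eq_true] at hlev
    obtain ⟨⟨⟨hb0, hb1⟩, ht0⟩, ht1⟩ := hlev
    simp only [PlanD.kmin, hkind] at hkm
    have hc3n : cls z < 3 := by unfold cls; omega
    have hcz3 : (cls z : ℤ) < 3 := by exact_mod_cast hc3n
    obtain ⟨ℓ, hℓa, hℓb, hℓ⟩ := exists_level_mod3 (a := -P.lamMin) (b := (k : ℤ) - P.lamMax) (r := (cls z : ℤ))
      (by unfold KMAX at hk hkm; omega) (by positivity) hcz3
    have hc0mod : ((cls z : ℕ) : ℤ) % 3 = (cls z : ℤ) := by omega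
    have hkmod := Int.emod_emod_of_dvd (k : ℤ) (dvd_refl (3 : ℤ))
    have hL : LevelOK k C ℓ P := by
      apply levelOK_of_contacts (by omega) (by omega)
      · intro d hd e
        have hcond : ((d - P.lamMin) % 3 == (C.c0 : ℤ) % 3) = true := by
          rw [beq_iff_eq, show d - P.lamMin = ℓ by omega, hℓ]; simp [hC, hc0mod]
        rcases hd with rfl | rfl
        · exact bimp_mp hb0 hcond
        · exact bimp_mp hb1 hcond
      · intro d hd e
        have hcond : (((C.kr : ℤ) - d - P.lamMax) % 3 == (C.c0 : ℤ) % 3) = true := by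
          rw [beq_iff_eq]
          have e2 : (k : ℤ) - d - P.lamMax = ℓ := by omega
          simp only [hC, Ctx.of_kr, Ctx.of_c0, Int.natCast_emod, hc0mod]
          rw [← hℓ, ← e2]; push_cast; omega
        rcases hd with rfl | rfl
        · exact bimp_mp ht0 (by simpa using hcond)
        · exact bimp_mp ht1 hcond
    -- all options are rides with envelope `any`
    simp only [PlanD.envOK, hkind, List.all_cons, List.all_nil, Bool.and_true, Bool.and_eq_true] at henv
    obtain ⟨e1, e2, e3a, e3b⟩ := henv
    have any_of : ∀ {t : TermD}, t.isRideAny = true → ∃ a, t = TermD.ride a Env.any := by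
      intro t h
      cases t with
      | exact v => simp [TermD.isRideAny] at h
      | ride a e => cases e <;> simp [TermD.isRideAny] at h; exact ⟨a, rfl⟩
    obtain ⟨a1, ht1⟩ := any_of e1; obtain ⟨a2, ht2⟩ := any_of e2; obtain ⟨a3, ht3a⟩ := any_of e3a; obtain ⟨a4, ht3b⟩ := any_of e3b
    exact swap_of_check hℓ hk5 hP hL hne hE₁ hE₂ hw' (serves_ride_any ht1 hf1 hc1 (hkind ▸ ha1) ℓ) (serves_ride_any ht2 hf2 hc2 (hkind ▸ ha2) ℓ)
      (serves_ride_any ht3a hf3a hc3 (hkind ▸ ha3a) ℓ) (serves_ride_any ht3b hf3b hc3 (hkind ▸ ha3b) ℓ)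
  · ---------------------------------------------------------------- bot ell
    simp only [PlanD.levelsOK, hkind, Bool.and_eq_true, beq_iff_eq, decide_eq_true_eq] at hlev
    obtain ⟨⟨⟨hres, h0⟩, hb0⟩, hb1⟩ := hlev
    simp only [PlanD.kmin, hkind] at hkm
    have hℓ : ell % 3 = (cls z : ℤ) := by
      have hc3n : cls z < 3 := by unfold cls; omega
      have : ((cls z : ℕ) : ℤ) % 3 = cls z := by omega
      simpa [hC, this] using hres
    have hL : LevelOK k C ell P := by
      apply levelOK_of_contacts h0 (by unfold KMAX at hk hkm; omega)
      · intro d hd e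
        rcases hd with rfl | rfl
        · exact bimp_mp hb0 (by simp [e])
        · exact bimp_mp hb1 (by simp [e])
      · intro d hd e; unfold KMAX at hk hkm; omega
    -- Serves for each terminal option under kind `bot`
    simp only [PlanD.envOK, hkind, List.all_cons, List.all_nil, Bool.and_true, Bool.and_eq_true] at henv
    obtain ⟨e1, e2, e3a, e3b⟩ := henv
    have srv : ∀ {t : TermD} {X : slab111 k} {c : Col}, t.botEnvOK C.c0 ell = true → (∀ v, t = TermD.exact v → v ∈ P.rigid) → t.col = c →
        sh X = vcol z c → t.allows C P.kind (statusOf k (lev (X : Site 3))) = true → Serves k z ell C t X := by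
      intro t X c henv hexr hcol hs hal
      have hX0 : 0 ≤ lev (X : Site 3) ∧ lev (X : Site 3) ≤ k := ⟨(adm_self X).2.1, (adm_self X).2.2⟩
      rcases t with v | ⟨a, e⟩
      · simp only [TermD.allows, hkind, Bool.and_eq_true, decide_eq_true_eq, beq_iff_eq] at hal
        obtain ⟨hs2, hev⟩ := hal
        obtain ⟨-, hsv⟩ := level_of_status_le_two hk5 hX0.1 hX0.2 hs2
        simp only [TermD.col] at hcol
        exact serves_exact hℓ hL hv0 (hexr v rfl) (by rw [hs, hcol]) (by rw [← hsv, ← hev]) rfl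
      · simp only [TermD.col] at hcol
        simp only [TermD.allows, hkind, Bool.and_eq_true] at hal
        obtain ⟨⟨hst, henv'⟩, -⟩ := hal
        refine ⟨hcol ▸ hs, hst, ?_⟩
        cases e with
        | any => trivial
        | ge fl =>
          simp only [TermD.botEnvOK, decide_eq_true_eq, Bool.and_eq_true] at henv henv'
          have h3 := three_le_of_status_ge_nine hk5 hX0.1 hX0.2 henv'.1
          have := botFloor_le (c0 := cls z) h3 (hcol ▸ dvd_level_cls hs)
          show fl ≤ lev (X : Site 3) - ell + min a.ext 0
          simp only [hC, Ctx.of_c0] at henv; omega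
        | le ce => simp [TermD.botEnvOK] at henv
    exact swap_of_check hℓ hk5 hP hL hne hE₁ hE₂ hw' (srv e1 hex1 hf1 hc1 (hkind ▸ ha1)) (srv e2 hex2 hf2 hc2 (hkind ▸ ha2))
      (srv e3a hex3a hf3a hc3 (hkind ▸ ha3a)) (srv e3b hex3b hf3b hc3 (hkind ▸ ha3b))
  · ---------------------------------------------------------------- top m
    simp only [PlanD.levelsOK, hkind, Bool.and_eq_true, beq_iff_eq, decide_eq_true_eq] at hlev
    obtain ⟨⟨⟨hres, hm⟩, ht0⟩, ht1⟩ := hlev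
    simp only [PlanD.kmin, hkind] at hkm
    set ℓ := (k : ℤ) - m with hℓdef
    have hℓ : ℓ % 3 = (cls z : ℤ) := by
      have hc3n : cls z < 3 := by unfold cls; omega
      have h3 : ((cls z : ℕ) : ℤ) % 3 = cls z := by omega
      have := Int.emod_emod_of_dvd (k : ℤ) (dvd_refl (3 : ℤ))
      simp only [hC, Ctx.of_kr, Ctx.of_c0, Int.natCast_emod] at hres; push_cast at hres
      rw [hℓdef]; omega
    have hL : LevelOK k C ℓ P := by
      apply levelOK_of_contacts (by unfold KMAX at hk hkm; omega) (by omega)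
      · intro d hd e; unfold KMAX at hk hkm; omega
      · intro d hd e
        rcases hd with rfl | rfl
        · exact bimp_mp ht0 (by rw [beq_iff_eq]; omega)
        · exact bimp_mp ht1 (by rw [beq_iff_eq]; omega)
    simp only [PlanD.envOK, hkind, List.all_cons, List.all_nil, Bool.and_true, Bool.and_eq_true] at henv
    obtain ⟨e1, e2, e3a, e3b⟩ := henv
    have srv : ∀ {t : TermD} {X : slab111 k} {c : Col}, t.topEnvOK C.c0 C.kr m = true → (∀ v, t = TermD.exact v → v ∈ P.rigid) → t.col = c →
        sh X = vcol z c → t.allows C P.kind (statusOf k (lev (X : Site 3))) = true → Serves k z ℓ C t X := by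
      intro t X c henv hexr hcol hs hal
      have hX0 : 0 ≤ lev (X : Site 3) ∧ lev (X : Site 3) ≤ k := ⟨(adm_self X).2.1, (adm_self X).2.2⟩
      rcases t with v | ⟨a, e⟩
      · simp only [TermD.allows, hkind, Bool.and_eq_true, decide_eq_true_eq, beq_iff_eq] at hal
        obtain ⟨⟨hs10, -⟩, hev⟩ := hal
        obtain ⟨-, hsv⟩ := level_of_status_ge_ten hk5 hX0.1 hX0.2 hs10
        simp only [TermD.col] at hcol
        exact serves_exact hℓ hL hv0 (hexr v rfl) (by rw [hs, hcol]) (by rw [hℓdef]; omega) rfl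
      · simp only [TermD.col] at hcol
        simp only [TermD.allows, hkind, Bool.and_eq_true] at hal
        obtain ⟨⟨hst, henv'⟩, -⟩ := hal
        refine ⟨hcol ▸ hs, hst, ?_⟩
        cases e with
        | any => trivial
        | le ce =>
          simp only [TermD.topEnvOK, decide_eq_true_eq] at henv henv'
          have hk3 := level_of_status_le_nine hk5 hX0.1 hX0.2 henv'
          have := le_sub_topOff (k := k) (c0 := cls z) hk3 (hcol ▸ dvd_level_cls hs)
          show lev (X : Site 3) - ℓ + max a.ext 0 ≤ ce
          simp only [hC, Ctx.of_c0, Ctx.of_kr] at henv; rw [hℓdef]; omega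
        | ge fl => simp [TermD.topEnvOK] at henv
    exact swap_of_check hℓ hk5 hP hL hne hE₁ hE₂ hw' (srv e1 hex1 hf1 hc1 (hkind ▸ ha1)) (srv e2 hex2 hf2 hc2 (hkind ▸ ha2))
      (srv e3a hex3a hf3a hc3 (hkind ▸ ha3a)) (srv e3b hex3b hf3b hc3 (hkind ▸ ha3b))
  · ---------------------------------------------------------------- stk lam0 low
    obtain ⟨hc12, hlt⟩ := hstk lam0 low hkind
    simp only [PlanD.levelsOK, hkind, Bool.and_eq_true, decide_eq_true_eq] at hlev
    obtain ⟨hlo, hhi⟩ := hlev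
    simp only [PlanD.envOK, hkind, Bool.and_eq_true, List.all_cons, List.all_nil, Bool.and_true] at henv
    obtain ⟨henv12, e3a, e3b⟩ := henv
    -- the low/high terminals
    set tlo := if low then P.t1 else P.t2 with htlo
    set thi := if low then P.t2 else P.t1 with hthi
    -- extract the shape: tlo = exact v, thi = ride a (ge fl)
    obtain ⟨v, a, fl, htl, hth, hv, hfl⟩ : ∃ v a fl, tlo = TermD.exact v ∧ thi = TermD.ride a (Env.ge fl) ∧ v = ((a.c.1, a.c.2), lam0) ∧
        fl ≤ lam0 + 3 + min a.ext 0 := by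
      revert henv12
      cases tlo with
      | ride _ _ => simp [stkPairOK]
      | exact v =>
        cases thi with
        | exact _ => simp [stkPairOK]
        | ride a e =>
          cases e with
          | any => simp [stkPairOK]
          | le _ => simp [stkPairOK]
          | ge fl =>
            simp only [stkPairOK, Bool.and_eq_true, beq_iff_eq, decide_eq_true_eq]
            rintro ⟨h1, h2⟩; exact ⟨v, a, fl, rfl, rfl, h1, h2⟩
    -- the low / high terminal vertices and their data
    set Elo := if low then E₁ else E₂ with hElo
    set Ehi := if low then E₂ else E₁ with hEhi
    have hcol_lo : sh Elo = vcol z c1 := by rw [hElo]; split_ifs; exact hc1; exact hc12 ▸ hc2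
    have hcol_hi : sh Ehi = vcol z c1 := by rw [hEhi]; split_ifs; exact hc12 ▸ hc2; exact hc1
    have hlt' : lev (Elo : Site 3) < lev (Ehi : Site 3) := by rw [hElo, hEhi]; split_ifs with hl <;> simpa [hl] using hlt
    have hne' : Elo ≠ Ehi := by rw [hElo, hEhi]; split_ifs; exact hne; exact hne.symm
    have hgap := three_le_sub_of_same_col (by rw [hcol_lo, hcol_hi]) hlt'
    -- the terminal options of the low/high vertices, with fits/allows
    have hflo : tlo.col = c1 := by rw [htlo]; split_ifs; exact hf1; exact hc12 ▸ hf2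
    have hfhi : thi.col = c1 := by rw [hthi]; split_ifs; exact hc12 ▸ hf2; exact hf1
    have halo : tlo.allows C P.kind (statusOf k (lev (Elo : Site 3))) = true := by rw [htlo, hElo]; split_ifs; exact ha1; exact ha2
    have hahi : thi.allows C P.kind (statusOf k (lev (Ehi : Site 3))) = true := by rw [hthi, hEhi]; split_ifs; exact ha2; exact ha1
    rw [htl] at hflo halo; rw [hth] at hfhi hahi
    simp only [TermD.col] at hflo hfhi
    simp only [TermD.allows, hkind, beq_iff_eq] at halo
    simp only [TermD.allows, hkind, Bool.and_eq_true, beq_iff_eq, decide_eq_true_eq] at hahi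
    obtain ⟨⟨hst_hi, -⟩, hs9⟩ := hahi
    have hX0 : ∀ X : slab111 k, 0 ≤ lev (X : Site 3) ∧ lev (X : Site 3) ≤ k := fun X => ⟨(adm_self X).2.1, (adm_self X).2.2⟩
    obtain ⟨h3lo, hk3lo⟩ := level_of_status_eq_nine hk5 (hX0 Elo).1 (hX0 Elo).2 halo
    obtain ⟨h3hi, hk3hi⟩ := level_of_status_eq_nine hk5 (hX0 Ehi).1 (hX0 Ehi).2 hs9
    -- the reference level
    set ℓ := lev (Elo : Site 3) - lam0 with hℓdef
    have hvrig : v ∈ P.rigid := by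
      rw [htlo] at htl; split_ifs at htl
      · exact hex1 v htl
      · exact hex2 v htl
    have hvOKv := hv0 v hvrig
    rw [vOK_iff] at hvOKv
    have hℓ : ℓ % 3 = (cls z : ℤ) := by
      have hcl := dvd_level_cls hcol_lo
      have hv2 : (3 : ℤ) ∣ lam0 - lvlC c1 := by
        have e2 : v.2 = lam0 := by rw [hv]
        rw [← hflo, ← e2]; simpa [RAdm, lvlC] using hvOKv
      have hc3n : cls z < 3 := by unfold cls; omega
      rw [hℓdef]; omega
    have hL : LevelOK k C ℓ P := by
      apply levelOK_of_contacts (by omega) (by omega)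
      · intro d hd e; omega
      · intro d hd e; omega
    have hSlo : Serves k z ℓ C tlo Elo := by
      rw [htl]
      exact serves_exact hℓ hL hv0 hvrig (by rw [hcol_lo, ← hflo, hv]) (by rw [hv, hℓdef]; ring) rfl
    have hShi : Serves k z ℓ C thi Ehi := by
      rw [hth]
      refine ⟨hfhi ▸ hcol_hi, hst_hi, ?_⟩
      show fl ≤ lev (Ehi : Site 3) - ℓ + min a.ext 0
      rw [hℓdef]; omega
    have any_of : ∀ {t : TermD}, t.isRideAny = true → ∃ a, t = TermD.ride a Env.any := by
      intro t h
      cases t with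
      | exact v => simp [TermD.isRideAny] at h
      | ride a e => cases e <;> simp [TermD.isRideAny] at h; exact ⟨a, rfl⟩
    obtain ⟨a3, ht3a⟩ := any_of e3a; obtain ⟨a4, ht3b⟩ := any_of e3b
    have hS1 : Serves k z ℓ C P.t1 E₁ := by
      by_cases hl : low = true
      · have : tlo = P.t1 := by rw [htlo]; simp [hl]
        have hE : Elo = E₁ := by rw [hElo]; simp [hl]
        rw [← this, ← hE]; exact hSlo
      · have : thi = P.t1 := by rw [hthi]; simp [hl]
        have hE : Ehi = E₁ := by rw [hEhi]; simp [hl]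
        rw [← this, ← hE]; exact hShi
    have hS2 : Serves k z ℓ C P.t2 E₂ := by
      by_cases hl : low = true
      · have : thi = P.t2 := by rw [hthi]; simp [hl]
        have hE : Ehi = E₂ := by rw [hEhi]; simp [hl]
        rw [← this, ← hE]; exact hShi
      · have : tlo = P.t2 := by rw [htlo]; simp [hl]
        have hE : Elo = E₂ := by rw [hElo]; simp [hl]
        rw [← this, ← hE]; exact hSlo
    exact swap_of_check hℓ hk5 hP hL hne hE₁ hE₂ hw' hS1 hS2 (serves_ride_any ht3a hf3a hc3 (hkind ▸ ha3a) ℓ) (serves_ride_any ht3b hf3b hc3 (hkind ▸ ha3b) ℓ)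

end Slab111

end Summit.CriticalPhenomena.PercolationContinuityZ3.Theorems.Transplant
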